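import Mathlib
import Literature.Computability.AlgebraicComplexity.NestFreeMatchingPoly
import Literature.Barriers.ValiantsHypothesis.MonotoneGapParseTrees
import Summits.ValiantsHypothesis.ValiantsHypothesis.Theorems.FifoMatchingNNDivisionHardStackPowers
import Summits.ValiantsHypothesis.ValiantsHypothesis.Theorems.FifoMatchingNNDivisionHardPinBlock
import HarnessLib

/-!
# Route FifoMatching — crux `NNDivisionHard` (stmt-ValiantsHypothesis-21181): THE PINNED RAINBOW FACE OF `NFP_n` IS `x^{pins} · NN_a`

The face identification asked for by `…NNDivisionHardFaceReading` / `…NNDivisionHardStackPowers` («WHAT REMAINS … M-sized,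
next hand»).  Block size `a` with `4a+2 ≤ 2n`, `n ≤ 3a+1`; direction `w = prWeight n a = (n+1)·𝟙_R + 𝟙_{pins}`
(`R` = rainbow arcs `(i, 2n−1−i)`, pins = the pin matching of `[2a, 2n)`, which contains the rainbow arc `(2a, 2n−1−2a)`):

* `weight_eq` — `weight_w(χ_M) = (n+1)·#{rainbow arcs of M} + #{pin arcs of M}`; `rainbowCount_le_one` — a NEST-FREE
  matching has at most ONE rainbow arc (two rainbow arcs nest); `pinCount_le` — at most `#pin openers` pin arcs;
* `weight_le`, ★ `weight_eq_max_iff` — every nest-free perfect matching weighs `≤ W := (n+1) + #pin openers`, with equality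
  iff it FOLLOWS THE PINS on `[2a, 2n)`; ★ `filter_max_eq_image` — the `w`-maximal nest-free perfect matchings of `[0, 2n)`
  are exactly the gluings `glue N`, `N` a nest-free perfect matching of `[0, 2a)`;
* `topComponent_sum_arcMonomial` — the top `w`-component of `Σ_{M ∈ S} x^M` is the sub-sum over the `w`-maximal `M`;
  `arcMonomial_glue` — `x^{glue N} = x^{pins} · ι(x^N)` (`ι = blockEmb`);
* ★★ `topComponent_eq` — **`top_w(NN_n) = x^{pins} · ι(NN_a)`**.

Consumed by `…NNDivisionHardStackPowersQueue` (stack powers are not certificates).  HONEST FRAMING: a face identification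
in the monotone world; stmt-21181 stays OPEN; nothing here bears on `NNNotVP` or on VP ≠ VNP (NOT proved).
References: Chen–Deng–Du–Stanley–Yan 2007 §1 [ChenDengDuStanleyYan2007]; Jukna–Seiwert–Sergeev 2022 Thm 1
[JuknaSeiwertSergeev2022]; Hrubeš–Yehudayoff 2021 §6 Problem 2 [HrubesYehudayoff2021].
-/

noncomputable section

-- Sub = Summit single-conjunct layout: the duplicated namespace component is mandated by the tree.
set_option linter.dupNamespace false
set_option autoImplicit false

namespace Summit.ValiantsHypothesis.ValiantsHypothesis.Theorems.FifoMatching.NNDivisionHard.StackPowersQueue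

open Finset MvPolynomial Literature.Computability.AlgebraicComplexity
open Summit.ValiantsHypothesis.ValiantsHypothesis.Theorems.ZeroOneTransfer.Negative (topComponent coeff_topComponent)
open Summit.ValiantsHypothesis.ValiantsHypothesis.Theorems.FifoMatching.NNDivisionHard.StackPowers
  (weight_arcExponent_eq_sum_openers)
open scoped NNReal BigOperators

variable {n a : ℕ}

/-! ### §1 Weights in the pinned rainbow direction -/

/-- `𝟙_{pins} ≤ 1`. [folklore] -/
theorem pinWeight_le_one (e : Fin (2 * n) × Fin (2 * n)) : pinWeight n a e ≤ 1 := by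
  unfold pinWeight; split_ifs <;> simp

/-- The pinned rainbow direction has the shape `B·𝟙_R + w₁` of `StackPowers` with `B = n + 1`, `w₁ = 𝟙_{pins}`. [folklore] -/
theorem prWeight_eq (e : Fin (2 * n) × Fin (2 * n)) :
    prWeight n a e = (n + 1) * (if e.2 = Fin.rev e.1 then 1 else 0) + pinWeight n a e := rfl

/-- **Weight in the pinned rainbow direction** = `(n+1)·#rainbow arcs + #pin arcs`. [folklore] -/
theorem weight_eq (M : Fin (2 * n) → Fin (2 * n)) :
    Finsupp.weight (prWeight n a) (arcExponent M) = (n + 1) * rainbowCount M + pinCount n a M := by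
  rw [rainbowCount, pinCount, weight_arcExponent_eq_sum_openers]
  simp only [prWeight, pinWeight]
  rw [Finset.sum_add_distrib, ← Finset.mul_sum, Finset.sum_boole, Finset.sum_boole, Nat.cast_id, Nat.cast_id]

/-- A NEST-FREE matching has at most ONE rainbow arc (two rainbow arcs nest). [folklore] -/
theorem rainbowCount_le_one {M : Fin (2 * n) → Fin (2 * n)} (hM : M ∈ nestFreeMatchings (2 * n)) :
    rainbowCount M ≤ 1 := by
  obtain ⟨-, hnest⟩ := mem_nestFreeMatchings.1 hM
  rw [rainbowCount, Finset.card_le_one]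
  intro i hi j hj
  rw [Finset.mem_filter, mem_openers] at hi hj
  by_contra hne
  rcases lt_or_gt_of_ne hne with h | h
  · exact hnest i j h hj.1 (by rw [hj.2, hi.2]; exact Fin.rev_lt_rev.2 h)
  · exact hnest j i h hi.1 (by rw [hi.2, hj.2]; exact Fin.rev_lt_rev.2 h)

/-- The pin arcs of `M` are pin openers. [folklore] -/
theorem pinFilter_subset (M : Fin (2 * n) → Fin (2 * n)) :
    ((openers M).filter fun i : Fin (2 * n) =>
        2 * a ≤ (i : ℕ) ∧ (i : ℕ) < (M i : ℕ) ∧ pinNat n a i = (M i : ℕ)) ⊆ pinOpeners n a := by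
  intro i hi
  rw [Finset.mem_filter] at hi
  rw [pinOpeners, Finset.mem_filter]
  exact ⟨mem_univ _, hi.2.1, by rw [hi.2.2.2]; exact hi.2.2.1⟩

/-- `#pin arcs ≤ #pin openers`. [folklore] -/
theorem pinCount_le (M : Fin (2 * n) → Fin (2 * n)) : pinCount n a M ≤ (pinOpeners n a).card :=
  card_le_card (pinFilter_subset M)

/-- **Upper bound**: every nest-free matching weighs at most `W = (n+1) + #pin openers`. [folklore] -/
theorem weight_le {M : Fin (2 * n) → Fin (2 * n)} (hM : M ∈ nestFreeMatchings (2 * n)) :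
    Finsupp.weight (prWeight n a) (arcExponent M) ≤ (n + 1) + (pinOpeners n a).card := by
  rw [weight_eq]
  have := rainbowCount_le_one hM
  have := pinCount_le (n := n) (a := a) M
  have h3 : (n + 1) * rainbowCount M ≤ (n + 1) * 1 := Nat.mul_le_mul_left _ (rainbowCount_le_one hM)
  omega

/-- **Equality case**: a nest-free perfect matching weighs `W` iff it FOLLOWS THE PINS on `[2a, 2n)`. [folklore] -/
theorem weight_eq_max_iff (h1 : 4 * a + 2 ≤ 2 * n) (h2 : n ≤ 3 * a + 1) {M : Fin (2 * n) → Fin (2 * n)}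
    (hM : M ∈ nestFreeMatchings (2 * n)) :
    Finsupp.weight (prWeight n a) (arcExponent M) = (n + 1) + (pinOpeners n a).card ↔
      ∀ p : Fin (2 * n), 2 * a ≤ (p : ℕ) → (M p : ℕ) = pinNat n a p := by
  have hPM := nestFreeMatchings_subset_perfectMatchings hM
  obtain ⟨hinv, hfp⟩ := mem_perfectMatchings.1 hPM
  rw [weight_eq]
  constructor
  · intro hW
    have hr := rainbowCount_le_one hM
    have hs := pinCount_le (n := n) (a := a) M
    have hsEq : pinCount n a M = (pinOpeners n a).card := by
      rcases Nat.le_one_iff_eq_zero_or_eq_one.1 hr with h | h <;> rw [h] at hW <;> omega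
    have hEq := Finset.eq_of_subset_of_card_le (pinFilter_subset (n := n) (a := a) M) (by rw [← pinCount, hsEq])
    -- every pin opener is followed
    have hop : ∀ p : Fin (2 * n), 2 * a ≤ (p : ℕ) → (p : ℕ) < pinNat n a p → (M p : ℕ) = pinNat n a p := by
      intro p hp hlt
      have hmem : p ∈ pinOpeners n a := Finset.mem_filter.2 ⟨mem_univ _, hp, hlt⟩
      rw [← hEq, Finset.mem_filter] at hmem
      exact hmem.2.2.2.symm
    intro p hp
    by_cases hlt : (p : ℕ) < pinNat n a p
    · exact hop p hp hlt
    · -- `p` is a pin closer: its partner `p'` is a pin opener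
      have hne := pinNat_ne h1 hp
      have hgt : pinNat n a p < (p : ℕ) := lt_of_le_of_ne (not_lt.1 hlt) hne
      set p' : Fin (2 * n) := pinFin n a p with hp'
      have hv : (p' : ℕ) = pinNat n a p := val_pinFin h1 h2 p
      have hp'a : 2 * a ≤ (p' : ℕ) := by rw [hv]; exact le_pinNat h1 _
      have hpp : pinNat n a p' = p := by rw [hv]; exact pinNat_pinNat h1 h2 hp p.isLt
      have h3 := hop p' hp'a (by rw [hpp, hv]; exact hgt)
      rw [hpp] at h3
      have hMp' : M p' = p := Fin.ext h3
      calc (M p : ℕ) = (M (M p') : ℕ) := by rw [hMp']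
        _ = p' := by rw [hinv]
        _ = pinNat n a p := hv
  · intro hagree
    have hsub : pinOpeners n a ⊆ (openers M).filter fun i : Fin (2 * n) =>
        2 * a ≤ (i : ℕ) ∧ (i : ℕ) < (M i : ℕ) ∧ pinNat n a i = (M i : ℕ) := by
      intro p hp
      rw [pinOpeners, Finset.mem_filter] at hp
      have h3 := hagree p hp.2.1
      refine Finset.mem_filter.2 ⟨mem_openers.2 ?_, hp.2.1, ?_, h3.symm⟩
      · rw [Fin.lt_def, h3]; exact hp.2.2
      · rw [h3]; exact hp.2.2
    have hs : (pinOpeners n a).card ≤ pinCount n a M := card_le_card hsub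
    have hs' := pinCount_le (n := n) (a := a) M
    -- the rainbow arc `(2a, 2n−2a−1)` is an arc of `M`
    have h2a : 2 * a < 2 * n := by omega
    set i₀ : Fin (2 * n) := ⟨2 * a, h2a⟩ with hi₀
    have hMi₀ : (M i₀ : ℕ) = 2 * n - 2 * a - 1 := by rw [hagree i₀ le_rfl]; exact pinNat_base n a
    have hmem : i₀ ∈ (openers M).filter fun i => M i = Fin.rev i := by
      refine Finset.mem_filter.2 ⟨mem_openers.2 ?_, Fin.ext ?_⟩
      · rw [Fin.lt_def, hMi₀]; change 2 * a < _; omega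
      · rw [hMi₀, Fin.val_rev]; change _ = 2 * n - (2 * a + 1); omega
    have hr : 1 ≤ rainbowCount M := Finset.card_pos.2 ⟨i₀, hmem⟩
    have hr' := rainbowCount_le_one hM
    have : rainbowCount M = 1 := le_antisymm hr' hr
    rw [this]; omega

/-- **THE `w`-MAXIMAL NEST-FREE MATCHINGS ARE EXACTLY THE GLUINGS** `glue N`, `N` a nest-free perfect matching of
`[0, 2a)`. [folklore] -/
theorem filter_max_eq_image (h1 : 4 * a + 2 ≤ 2 * n) (h2 : n ≤ 3 * a + 1) :
    (nestFreeMatchings (2 * n)).filter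
        (fun M => Finsupp.weight (prWeight n a) (arcExponent M) = (n + 1) + (pinOpeners n a).card) =
      (nestFreeMatchings (2 * a)).image (glue n a) := by
  have hle : 2 * a ≤ 2 * n := by omega
  ext M
  rw [Finset.mem_filter, Finset.mem_image]
  constructor
  · rintro ⟨hM, hW⟩
    have hagree := (weight_eq_max_iff h1 h2 hM).1 hW
    exact ⟨restrictM hle M, restrictM_mem h1 hle hM hagree,
      glue_restrictM h1 h2 hle (nestFreeMatchings_subset_perfectMatchings hM) hagree⟩
  · rintro ⟨N, hN, rfl⟩
    have hG := glue_mem_nestFreeMatchings h1 h2 hN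
    exact ⟨hG, (weight_eq_max_iff h1 h2 hG).2 fun p hp => val_glue_of_le h1 h2 N hp⟩

/-! ### §2 Top components of matching polynomials and the arc monomial of a gluing -/

/-- The top `w`-component of `Σ_{M ∈ S} x^M` (`S` perfect matchings) is the sub-sum over the `w`-maximal members,
when the maximum `W` is attained. [folklore] -/
theorem topComponent_sum_arcMonomial {m : ℕ} (w : Fin m × Fin m → ℕ) {S : Finset (Fin m → Fin m)}
    (hS : S ⊆ perfectMatchings m) {W : ℕ} (hle : ∀ M ∈ S, Finsupp.weight w (arcExponent M) ≤ W)
    (hex : ∃ M ∈ S, Finsupp.weight w (arcExponent M) = W) :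
    topComponent w (∑ M ∈ S, arcMonomial ℝ≥0 M) =
      ∑ M ∈ S.filter (fun M => Finsupp.weight w (arcExponent M) = W), arcMonomial ℝ≥0 M := by
  classical
  have hdeg : weightedTotalDegree w (∑ M ∈ S, arcMonomial ℝ≥0 M) = W := by
    apply le_antisymm
    · unfold weightedTotalDegree
      refine Finset.sup_le fun d hd => ?_
      rw [support_sum_arcMonomial hS, Finset.mem_image] at hd
      obtain ⟨M, hM, rfl⟩ := hd
      exact hle M hM
    · obtain ⟨M, hM, hW⟩ := hex
      rw [← hW]
      apply le_weightedTotalDegree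
      rw [support_sum_arcMonomial hS]
      exact mem_image_of_mem _ hM
  ext d
  rw [coeff_topComponent, hdeg, coeff_sum_arcMonomial hS,
    coeff_sum_arcMonomial ((Finset.filter_subset _ _).trans hS)]
  by_cases hd : Finsupp.weight w d = W
  · rw [if_pos hd]
    have hiff : (∃ M ∈ S, arcExponent M = d) ↔
        ∃ M ∈ S.filter (fun M => Finsupp.weight w (arcExponent M) = W), arcExponent M = d := by
      constructor
      · rintro ⟨M, hM, h⟩
        exact ⟨M, Finset.mem_filter.2 ⟨hM, by rw [h]; exact hd⟩, h⟩
      · rintro ⟨M, hM, h⟩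
        exact ⟨M, (Finset.mem_filter.1 hM).1, h⟩
    rw [if_congr hiff rfl rfl]
  · rw [if_neg hd, if_neg]
    rintro ⟨M, hM, rfl⟩
    exact hd (Finset.mem_filter.1 hM).2

/-- The block embedding is injective. [folklore] -/
theorem blockEmb_injective (hle : 2 * a ≤ 2 * n) : Function.Injective (blockEmb hle) :=
  (Fin.castLE_injective hle).prodMap (Fin.castLE_injective hle)

/-- The left-block part of `univ : Finset (Fin (2n))` is the image of `Fin (2a)`. [folklore] -/
theorem filter_lt_eq_map (hle : 2 * a ≤ 2 * n) :
    (univ : Finset (Fin (2 * n))).filter (fun i : Fin (2 * n) => (i : ℕ) < 2 * a) =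
      (univ : Finset (Fin (2 * a))).map (Fin.castLEEmb hle) := by
  ext i
  simp only [Finset.mem_filter, Finset.mem_univ, true_and, Finset.mem_map, Fin.castLEEmb_apply]
  constructor
  · intro h
    exact ⟨⟨i, h⟩, Fin.ext rfl⟩
  · rintro ⟨j, rfl⟩
    rw [Fin.val_castLE]
    exact j.isLt

/-- The pin openers are the openers of the pin block. [folklore] -/
theorem filter_ge_filter_eq_pinOpeners (h1 : 4 * a + 2 ≤ 2 * n) (h2 : n ≤ 3 * a + 1) :
    ((univ : Finset (Fin (2 * n))).filter (fun i : Fin (2 * n) => ¬ (i : ℕ) < 2 * a)).filter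
        (fun i : Fin (2 * n) => i < pinFin n a i) = pinOpeners n a := by
  ext i
  simp only [pinOpeners, Finset.mem_filter, Finset.mem_univ, true_and, not_lt, Fin.lt_def, val_pinFin h1 h2]

/-- **`x^{glue N} = x^{pins} · ι(x^N)`.** [folklore] -/
theorem arcMonomial_glue (h1 : 4 * a + 2 ≤ 2 * n) (h2 : n ≤ 3 * a + 1) (hle : 2 * a ≤ 2 * n)
    (N : Fin (2 * a) → Fin (2 * a)) :
    arcMonomial ℝ≥0 (glue n a N) = monomial (pinExp n a) 1 * rename (blockEmb hle) (arcMonomial ℝ≥0 N) := by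
  unfold arcMonomial
  rw [← Finset.prod_filter_mul_prod_filter_not univ (fun i : Fin (2 * n) => (i : ℕ) < 2 * a),
    mul_comm ((monomial (pinExp n a)) (1 : ℝ≥0))]
  congr 1
  · -- the left block: reindex by `Fin (2a)` and rename
    rw [filter_lt_eq_map hle, Finset.prod_map, map_prod]
    refine Finset.prod_congr rfl fun j _ => ?_
    have hj : ((Fin.castLEEmb hle j : Fin (2 * n)) : ℕ) < 2 * a := by
      rw [Fin.castLEEmb_apply, Fin.val_castLE]; exact j.isLt
    have hglue : glue n a N (Fin.castLEEmb hle j) = Fin.castLE hle (N j) := by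
      apply Fin.ext
      rw [val_glue_of_lt h1 N hj, Fin.val_castLE]
      congr 2
    rw [hglue]
    have hiff : (Fin.castLEEmb hle j : Fin (2 * n)) < Fin.castLE hle (N j) ↔ j < N j := by
      rw [Fin.lt_def, Fin.lt_def, Fin.castLEEmb_apply, Fin.val_castLE, Fin.val_castLE]
    by_cases h : j < N j
    · rw [if_pos (hiff.2 h), if_pos h, rename_X]
      rfl
    · rw [if_neg (fun h' => h (hiff.1 h')), if_neg h, map_one]
  · -- the pin block: `Π_{p pin opener} x_(p, pin p) = x^{pins}`
    have hglue : ∀ i ∈ (univ : Finset (Fin (2 * n))).filter (fun i : Fin (2 * n) => ¬ (i : ℕ) < 2 * a),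
        glue n a N i = pinFin n a i := by
      intro i hi
      rw [Finset.mem_filter, not_lt] at hi
      exact Fin.ext (by rw [val_glue_of_le h1 h2 N hi.2, val_pinFin h1 h2])
    rw [Finset.prod_congr rfl (fun i hi => by rw [hglue i hi]), ← Finset.prod_filter,
      filter_ge_filter_eq_pinOpeners h1 h2, pinExp, monomial_sum_one]
    rfl

/-! ### §3 The face identification -/

/-- ★ **THE PINNED RAINBOW FACE OF `NFP_n` IS `x^{pins} · NN_a[0, 2a)`**: for `4a+2 ≤ 2n`, `n ≤ 3a+1`,
`top_w(NN_n) = x^{pins} · ι(NN_a)` in the pinned rainbow direction `w = (n+1)·𝟙_R + 𝟙_{pins}`. [folklore] -/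
theorem topComponent_eq (h1 : 4 * a + 2 ≤ 2 * n) (h2 : n ≤ 3 * a + 1) (hle : 2 * a ≤ 2 * n) :
    topComponent (prWeight n a) (nestFreeMatchingPoly n ℝ≥0) =
      monomial (pinExp n a) 1 * rename (blockEmb hle) (nestFreeMatchingPoly a ℝ≥0) := by
  rw [nestFreeMatchingPoly_eq_sum_arcMonomial,
    topComponent_sum_arcMonomial (prWeight n a) nestFreeMatchings_subset_perfectMatchings
      (W := (n + 1) + (pinOpeners n a).card) (fun M hM => weight_le hM)
      ⟨glue n a (shiftMatching a), glue_mem_nestFreeMatchings h1 h2 (shiftMatching_mem a),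
        (weight_eq_max_iff h1 h2 (glue_mem_nestFreeMatchings h1 h2 (shiftMatching_mem a))).2
          fun p hp => val_glue_of_le h1 h2 _ hp⟩,
    filter_max_eq_image h1 h2, Finset.sum_image fun N _ N' _ h => glue_injective h1 h,
    nestFreeMatchingPoly_eq_sum_arcMonomial, map_sum, Finset.mul_sum]
  exact Finset.sum_congr rfl fun N _ => arcMonomial_glue h1 h2 hle N

end Summit.ValiantsHypothesis.ValiantsHypothesis.Theorems.FifoMatching.NNDivisionHard.StackPowersQueue

end
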